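import Mathlib
import HarnessLib
import Summits.FinalStateConjecture.Statement
import Literature.Geometry.Lorentzian.LandauLifshitzPseudotensor

/-!
# Route EIHFluxBalance — `InertialRecession`, re-charting: the proper-time clock of a hole chart

Helper file for the crux `stmt-FinalStateConjecture-10166`
(`Summit.FinalStateConjecture.FinalStateConjecture.Theses.EIHFluxBalance.InertialRecession`),
line `sublinear-is-free-clean-window-charges`, stub `stub_rechart` (the transfer P2).

The hole chart of the transfer maps rest-frame Kerr–Schild coordinates `(τ, z̲′)` of hole `i` to
lab coordinates `(Tᵢ(τ, z̲′), ξᵢ(Tᵢ) + Sᵢ(Tᵢ) z̲′)`; along the centre (`z̲′ = 0`) the lab time is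
`T₀(τ)` with `dT₀/dτ = u⁰ᵢ(T₀)`, the painted Lorentz factor `u⁰ᵢ(t) = (Λᵢ(t) e₀)⁰ ∈ [1, γ]` —
hole time is the proper time of the painted centre, lagging lab time by `∫ (u⁰ − 1)`. This file
constructs that clock ONCE AND FOR ALL, with no ODE theory: `T₀` is the inverse of the explicit
primitive `G(T) = a + ∫_b^T ds / u⁰(s)`, a smooth strictly increasing bijection of `ℝ`
(`1/γ ≤ G′ ≤ 1`).

* `exists_properTimeClock'` (registered one-line form `exists_properTimeClock`) — for `f : ℝ → ℝ` smooth with `1 ≤ f ≤ γ` and any `a b`, there is a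
  smooth `T : ℝ → ℝ` with `T′ = f ∘ T` (as `HasDerivAt`), `T a = b`, strictly increasing,
  surjective, and `τ − σ ≤ T τ − T σ ≤ γ (τ − σ)` for `σ ≤ τ` (lab time runs at least as fast
  as hole time and at most `γ` times as fast).

[folklore calculus: inverse of a primitive; Mathlib `intervalIntegral.integral_hasDerivAt_right`,
`HasDerivAt.of_local_left_inverse`, `StrictMono.orderIsoOfSurjective`]
-/

noncomputable section

set_option linter.dupNamespace false

open Set Filter Function MeasureTheory
open scoped Topology ContDiff

namespace Summit.FinalStateConjecture.FinalStateConjecture.Theorems.SublinearIsFree.Rechart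

/-- A primitive of a smooth positive function bounded between `γ⁻¹` and `1`: smooth, derivative
`(f x)⁻¹`, two-sided linear growth. [folklore] -/
theorem exists_primitive_inv {f : ℝ → ℝ} {γ : ℝ} (hf : ContDiff ℝ ∞ f) (h1 : ∀ t, 1 ≤ f t)
    (hγ : ∀ t, f t ≤ γ) (a b : ℝ) :
    ∃ G : ℝ → ℝ, ContDiff ℝ ∞ G ∧ (∀ x, HasDerivAt G (f x)⁻¹ x) ∧ G b = a ∧
      (∀ x y, x ≤ y → γ⁻¹ * (y - x) ≤ G y - G x) ∧ (∀ x y, x ≤ y → G y - G x ≤ y - x) := by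
  have hfpos : ∀ t, 0 < f t := fun t ↦ lt_of_lt_of_le one_pos (h1 t)
  have hγpos : 0 < γ := lt_of_lt_of_le (hfpos 0) (hγ 0)
  have hinv : ContDiff ℝ ∞ fun t ↦ (f t)⁻¹ := hf.inv fun t ↦ (hfpos t).ne'
  have hcont : Continuous fun t ↦ (f t)⁻¹ := hinv.continuous
  let G : ℝ → ℝ := fun x ↦ a + ∫ t in b..x, (f t)⁻¹
  have hG : ∀ x, HasDerivAt G (f x)⁻¹ x := by
    intro x
    have h := intervalIntegral.integral_hasDerivAt_right (hcont.intervalIntegrable b x)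
      (hcont.stronglyMeasurableAtFilter volume (𝓝 x)) hcont.continuousAt
    simpa [G] using h.const_add a
  have hdiff : Differentiable ℝ G := fun x ↦ (hG x).differentiableAt
  have hderiv : deriv G = fun x ↦ (f x)⁻¹ := funext fun x ↦ (hG x).deriv
  refine ⟨G, ?_, hG, ?_, ?_, ?_⟩
  · rw [contDiff_infty_iff_deriv, hderiv]
    exact ⟨hdiff, hinv⟩
  · simp [G]
  · intro x y hxy
    refine mul_sub_le_image_sub_of_le_deriv hdiff (fun t ↦ ?_) hxy
    rw [hderiv]
    exact (inv_le_inv₀ hγpos (hfpos t)).mpr (hγ t)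
  · intro x y hxy
    have h := image_sub_le_mul_sub_of_deriv_le hdiff (C := 1) (fun t ↦ ?_) hxy
    · simpa using h
    · rw [hderiv]
      exact inv_le_one_of_one_le₀ (h1 t)

/-- **The proper-time clock.** For a smooth Lorentz-factor profile `f : ℝ → ℝ` with
`1 ≤ f ≤ γ` (the painted `u⁰ᵢ`), and any normalisation `T a = b`, there is a smooth, strictly
increasing, surjective `T : ℝ → ℝ` solving `T′(τ) = f (T τ)` for all `τ`, with
`τ − σ ≤ T τ − T σ ≤ γ (τ − σ)` for `σ ≤ τ`. Construction: the order-inverse of the primitive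
`G` of `1/f` (`exists_primitive_inv`); the derivative by `HasDerivAt.of_local_left_inverse`,
smoothness by induction on the order via `T′ = f ∘ T`. [folklore] -/
theorem exists_properTimeClock' {f : ℝ → ℝ} {γ : ℝ} (hf : ContDiff ℝ ∞ f) (h1 : ∀ t, 1 ≤ f t)
    (hγ : ∀ t, f t ≤ γ) (a b : ℝ) :
    ∃ T : ℝ → ℝ, ContDiff ℝ ∞ T ∧ (∀ τ, HasDerivAt T (f (T τ)) τ) ∧ T a = b ∧ StrictMono T ∧
      Surjective T ∧ (∀ σ τ, σ ≤ τ → τ - σ ≤ T τ - T σ) ∧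
      (∀ σ τ, σ ≤ τ → T τ - T σ ≤ γ * (τ - σ)) := by
  have hfpos : ∀ t, 0 < f t := fun t ↦ lt_of_lt_of_le one_pos (h1 t)
  have hγpos : 0 < γ := lt_of_lt_of_le (hfpos 0) (hγ 0)
  obtain ⟨G, hGs, hG, hGb, hGlo, hGhi⟩ := exists_primitive_inv hf h1 hγ a b
  have hdiff : Differentiable ℝ G := fun x ↦ (hG x).differentiableAt
  have hmono : StrictMono G := strictMono_of_deriv_pos fun x ↦ by
    rw [(hG x).deriv]
    exact inv_pos.mpr (hfpos x)
  -- `G` is a continuous bijection of `ℝ`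
  have htop : Tendsto G atTop atTop := by
    refine tendsto_atTop_mono' atTop ?_
      (tendsto_atTop_add_const_left _ (G 0) (Tendsto.const_mul_atTop (inv_pos.mpr hγpos)
        tendsto_id))
    filter_upwards [eventually_ge_atTop 0] with x hx
    have := hGlo 0 x hx
    simp only [sub_zero, id_eq] at this ⊢
    linarith
  have hbot : Tendsto G atBot atBot := by
    refine tendsto_atBot_mono' atBot ?_
      (tendsto_atBot_add_const_left _ (G 0) (Tendsto.const_mul_atBot (inv_pos.mpr hγpos)
        tendsto_id))
    filter_upwards [eventually_le_atBot 0] with x hx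
    have := hGlo x 0 hx
    simp only [id_eq, zero_sub] at this ⊢
    linarith
  have hsurj : Surjective G := hGs.continuous.surjective htop hbot
  let e : ℝ ≃o ℝ := hmono.orderIsoOfSurjective G hsurj
  have he : ∀ x, e x = G x := fun _ ↦ rfl
  let T : ℝ → ℝ := e.symm
  have hGT : ∀ τ, G (T τ) = τ := fun τ ↦ by
    show G (e.symm τ) = τ
    rw [← he, e.apply_symm_apply]
  have hTG : ∀ x, T (G x) = x := fun x ↦ by
    show e.symm (G x) = x
    rw [← he, e.symm_apply_apply]
  have hTc : Continuous T := e.symm.continuous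
  have hT : ∀ τ, HasDerivAt T (f (T τ)) τ := by
    intro τ
    have h := HasDerivAt.of_local_left_inverse hTc.continuousAt (hG (T τ))
      (inv_ne_zero (hfpos _).ne') (Eventually.of_forall hGT)
    simpa using h
  have hTd : Differentiable ℝ T := fun τ ↦ (hT τ).differentiableAt
  have hTderiv : deriv T = f ∘ T := funext fun τ ↦ (hT τ).deriv
  -- smoothness by induction on the order
  have hTn : ∀ n : ℕ, ContDiff ℝ n T := by
    intro n
    induction n with
    | zero => exact contDiff_zero.mpr hTc
    | succ n ih =>
      rw [Nat.cast_succ, contDiff_succ_iff_deriv, hTderiv]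
      exact ⟨hTd, fun h ↦ absurd h (by simp), (hf.of_le (by exact_mod_cast le_top)).comp ih⟩
  refine ⟨T, contDiff_infty.mpr hTn, hT, ?_, e.symm.strictMono, e.symm.surjective, ?_, ?_⟩
  · show T a = b
    rw [← hGb, hTG]
  · intro σ τ hστ
    have h := hGhi (T σ) (T τ) (e.symm.monotone hστ)
    rwa [hGT, hGT] at h
  · intro σ τ hστ
    have h := hGlo (T σ) (T τ) (e.symm.monotone hστ)
    rw [hGT, hGT] at h
    have := mul_le_mul_of_nonneg_left h hγpos.le
    rw [← mul_assoc, mul_inv_cancel₀ hγpos.ne', one_mul] at this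
    exact this

/-- Registered sub-goal form (stub `exists_properTimeClock` of the crux item) of
`exists_properTimeClock'`: the proper-time clock of a hole chart. [folklore] -/
theorem exists_properTimeClock : ∀ {f : ℝ → ℝ} {γ : ℝ}, ContDiff ℝ ((⊤ : ℕ∞) : WithTop ℕ∞) f → (∀ t, 1 ≤ f t) → (∀ t, f t ≤ γ) → ∀ (a b : ℝ), ∃ T : ℝ → ℝ, ContDiff ℝ ((⊤ : ℕ∞) : WithTop ℕ∞) T ∧ (∀ τ, HasDerivAt T (f (T τ)) τ) ∧ T a = b ∧ StrictMono T ∧ Function.Surjective T ∧ (∀ σ τ, σ ≤ τ → τ - σ ≤ T τ - T σ) ∧ (∀ σ τ, σ ≤ τ → T τ - T σ ≤ γ * (τ - σ)) :=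
  fun hf h1 hγ a b ↦ exists_properTimeClock' hf h1 hγ a b

end Summit.FinalStateConjecture.FinalStateConjecture.Theorems.SublinearIsFree.Rechart

end
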